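import Literature.MathematicalPhysics.KineticTheory.LambertianRedrawNondegenerate
import Literature.MathematicalPhysics.KineticTheory.Hilbert6Wave0

/-!
# Sketch — first lemmas of the crux idea cards for `LambertianEuler`
(crux stmt-AtomisticToContinuum-11854; ideator k = 2, round 1)

* Card `rule-indifference-steering` — first lemma `isotropicPairProduct_isMaxwellian`:
  a positive continuous one-particle velocity law whose pair product `h(v) h(v*)` is constant on
  every collision sphere `{(c + r n, c - r n) : |n| = 1}` (= zero Lambertian contact entropy
  production of the product state `∏ h(v_i)`, the ideal-gas kernel of
  `BoltzmannHypothesisBarrier` transported into the Lambertian gas) is a Maxwellian — modulo the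
  tree's named fact `IsCollisionInvariant.exists_eq_quadratic` (Boltzmann–Gronwall–Carleman).
* Card `cosine-povzner-ladder` — first lemma `lambert_povzner` / `lambertPair_povzner`:
  the GEOMETRY-UNIFORM Povzner inequality of the cosine redraw: for every contact normal `ω`,
  every `c` with `|c| ≤ 1` and every `k`,
  `E_ξ[(1 + ⟪c, n⟫)^k + (1 - ⟪c, n⟫)^k] ≤ 4 · 2^k / (k + 1)`, `n = lambertDir ω ξ`, `ξ` standard
  Gaussian; consequently `E_ξ[|v_i'|^{2k} + |v_j'|^{2k}] ≤ (4/(k+1)) (|v_i|² + |v_j|²)^k` for the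
  redrawn pair at ANY contact geometry (numerically: the sup over the angle `∠(c, ω)` is attained
  at `c ∥ ω`, where the value is `(k+1) 2^{-k} [2((2^{k+2}-1)/(k+2) - (2^{k+1}-1)/(k+1)) +
  2/((k+1)(k+2))] ↑ 4`).
-/

noncomputable section

open MeasureTheory ProbabilityTheory
open scoped InnerProductSpace

namespace Summit.AtomisticToContinuum.HydrodynamicLimit.Cruxes.LambertianEuler.Sketch

open Literature.MathematicalPhysics.KineticTheory Literature.Analysis.FluidPDE

/-- Velocity space. -/
abbrev V3 : Type := EuclideanSpace ℝ (Fin 3)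

/-- **Card A, first lemma.** Contact-isotropic product states are Maxwellian: if `h > 0` is
continuous and `h (c + r n) h (c - r n)` does not depend on the unit vector `n`, then `log h` is a
collision invariant, hence (named fact `exists_eq_quadratic`) quadratic, i.e. `h` is a
(wide-sense) Maxwellian. This is the statement that the Boltzmann-hypothesis barrier's formal
kernel (`idealGasState h`, stationary under free flight for EVERY `h`) is killed inside the
Lambertian gas: among product states only Maxwellian ones have zero contact entropy production. -/
theorem isotropicPairProduct_isMaxwellian
    (hquad : IsCollisionInvariant.exists_eq_quadratic (E := V3))
    (h : V3 → ℝ) (hpos : ∀ v, 0 < h v) (hcont : Continuous h)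
    (hiso : ∀ (c : V3) (r : ℝ) (n n' : V3), ‖n‖ = 1 → ‖n'‖ = 1 →
      h (c + r • n) * h (c - r • n) = h (c + r • n') * h (c - r • n')) :
    IsMaxwellian h := by
  sorry

/-- **Card B, first lemma (direction form).** Geometry-uniform Povzner bound for the cosine
(Lambert) redraw: the energy-split variable `s = ⟪c, n⟫`, `n = lambertDir ω ξ`, has
`E[(1+s)^k + (1-s)^k] ≤ 4 · 2^k/(k+1)` for every contact normal `ω ≠ 0` and every `|c| ≤ 1`
(no average over the impact parameter is needed: the cosine law has a bounded density at its
pole). -/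
theorem lambert_povzner (ω c : V3) (hω : ω ≠ 0) (hc : ‖c‖ ≤ 1) (k : ℕ) :
    ∫ ξ, ((1 + ⟪c, lambertDir ω ξ⟫_ℝ) ^ k + (1 - ⟪c, lambertDir ω ξ⟫_ℝ) ^ k)
        ∂(stdGaussian V3) ≤ 4 * 2 ^ k / (k + 1) := by
  sorry

/-- **Card B, first lemma (pair form).** At ANY contact geometry, the Lambertian redraw of a pair
satisfies `E_ξ[|v_i'|^{2k} + |v_j'|^{2k}] ≤ (4/(k+1)) (|v_i|² + |v_j|²)^k`: each collision of the
Lambertian gas destroys, in conditional expectation given the pre-collisional state, all but a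
fraction `4/(k+1)` of the pair's top-order velocity moment measured against the kinematic
maximum `(|v_i|²+|v_j|²)^k`. -/
theorem lambertPair_povzner {N : ℕ}
    (G : Geometry (Fin 3) (UnitAddTorus (Fin 3))) (i j : Fin N) (hij : i ≠ j)
    (z : Config N (Fin 3) (UnitAddTorus (Fin 3))) (hsep : G.sepVec (z i).1 (z j).1 ≠ 0) (k : ℕ) :
    ∫ ξ, (‖(lambertPair G i j z ξ i).2‖ ^ (2 * k) + ‖(lambertPair G i j z ξ j).2‖ ^ (2 * k))
        ∂(stdGaussian V3) ≤ 4 / (k + 1) * (‖(z i).2‖ ^ 2 + ‖(z j).2‖ ^ 2) ^ k := by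
  sorry

end Summit.AtomisticToContinuum.HydrodynamicLimit.Cruxes.LambertianEuler.Sketch

end
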